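import Summits.QuantumFields.YangMills.Theorems.UnitScaleTiltProp8AvgLipschitz
import Summits.QuantumFields.YangMills.Theorems.AlphaInputsT3ACMinimiserPin
import Summits.QuantumFields.YangMills.Theorems.UnitScaleTiltProp7DescendJunction
import Summits.QuantumFields.YangMills.Theorems.FluctuationComparisonRegPrIntLS2BetaSignedCombLipschitz
import Literature.MathematicalPhysics.QuantumFieldTheory.Balaban1983to89.T3PrintedRegularOrbits
import HarnessLib

/-!
# S2β · (Lπ) — THE DESCENT `D_{J,K}` IS LIPSCHITZ AT EVERY PLAQUETTE-REGULAR BASE POINT, IN THE (T)-CHAIN'S `Σ dist1²` CURRENCY — DISCHARGED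

Cell `ym3-torus` (YM ladder rung R3 = continuum `SU(2)` Yang–Mills on the three-torus at fixed lattice data — a RUNG: NOT d = 4, NOT infinite volume,
NOT a mass gap, NOT Clay).  Width seat `ym3-torus-px13` (gen 20).  Crux `stmt-QuantumFields-20520` (`…Theses.UnitScaleTilt.FluctuationComparisonRegPrIntL`),
LINE g18-1 S2β, the (T)-chain's displayed letter (Lπ) «descent-Lipschitz» (px8 g18's seam (E)(Ls)(Lπ); px21 g19's (T7) `(Lπ)_loc`);
`--kind proof --supports stmt-QuantumFields-20520 --as helper`, count-neutral, DEFINITION-FREE (0 `def`, 0 `instance`, 0 `notation`, 0 `sorry`, default heartbeats).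

WHAT IS PROVED (kinematics of the tree's own (0.4) average — NO gauge fixing, NO analytic letter):
* §1 ★ `norm_descendTo_sub_descendTo_le_of_iterSmall` — SUP FORM AT A SMALL HISTORY: iterated averages `M^i W` (`i < K − J`) `t`-small, `‖U ℓ − W ℓ‖ ≤ ρ` on every fine
  bond, `stokesConst·(t + 4·(30ℓ)^{K−J}·ρ) ≤ 1∕24` (`ℓ = 5L`) ⟹ `‖D U b − D W b‖ ≤ (30ℓ)^{K−J}·ρ` (`D = descendTo F ℰp J K hJK`) — ✓`Prop8Criticality.norm_iter_sub_iter_le_of_close`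
  ([Balaban1987RG1] (0.4)∕(0.11): the k-fold average is sup-norm Lipschitz at a CURVED small background) read at `descendTo` through ✓(J1) `Prop7DescendJunction.descendTo_apply`.
* §2 ★★ `norm_descendTo_sub_descendTo_le_of_plaqSmall` — SUP FORM AT A PLAQUETTE-REGULAR BASE POINT: `PlaqSmall (regThreshold F J K e) W`, `e` admissible as in
  [Balaban1985Averaging] (53) (`143·(7²∕4)²·e ≤ ⅓`, `2e ≤ 2δ₂∕(7L)²`) makes every iterated average `2e`-small (✓`MinimiserPin.plaqSmall_two_iter_blockAvg`, Prop. 2), so §1 applies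
  with `t = 2e`; `…_of_mem_regFibrePr` ∕ `…_gaugeAct_of_mem_regFibrePr`: the (T)-chain's base point `W ∈ regFibrePr F J K hJK e V` and every gauge copy `u • W` qualify.
* §3 ★★★ `sum_dist1_descendTo_sq_le_of_plaqSmall` — THE (T)-CHAIN'S CURRENCY: on the ball `Σ_ℓ dist1 (U ℓ·(W ℓ)⁻¹)² ≤ ρ²`,
  `Σ_b dist1 (D U b·(D W b)⁻¹)² ≤ #PBond_J · (30ℓ)^{2(K−J)} · Σ_ℓ dist1 (U ℓ·(W ℓ)⁻¹)²` (`dist1 (A·B⁻¹) = ‖A − B‖` on `SU(2)`, ✓`…S2BetaSignedCombLipschitz.dist1_mul_inv_eq_norm_sub`).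
* §4 ★★★ `exists_descentLipschitz_of_plaqSmall` ∕ `…_gaugeAct_of_mem_regFibrePr` (both orientations) — PACKAGED `(Lπ)_loc`: `∃ Kπ ρ₀ > 0` (depending on `L`, `K − J`,
  `#PBond_J`, `e` ONLY) with `Σ_ℓ dist1 (U ℓ·(W ℓ)⁻¹)² ≤ ρ₀² → Σ_b dist1 (D U b·(D W b)⁻¹)² ≤ Kπ² · Σ_ℓ dist1 (U ℓ·(W ℓ)⁻¹)²`; §5 `…_T`: the same with ✓(T2d)'s binders `(hε₀, hr3, hr2)`.
* §6 ★★★ `exists_supLipschitz_of_plaqSmall` ∕ `…_of_mem_regFibrePr` ∕ `exists_threshold_supLipschitz` — (T7b)'s `hLip` binder (px21 g19 00:44:07Z (B)) in its byte-exact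
  sup-norm shape `∃ ρ₀ Kπ, 0 < ρ₀ ∧ 0 ≤ Kπ ∧ ∀ B ρ, 0 ≤ ρ → ρ ≤ ρ₀ → (∀ ℓ, ‖↑(U₀ ℓ) − ↑(B ℓ)‖ ≤ ρ) → ∀ b, ‖↑(D U₀ b) − ↑(D B b)‖ ≤ Kπ·ρ`, and an `L`-only threshold `e_π(L)` edition.
So (Lπ) ∕ `(Lπ)_loc` LEAVES the (T)-chain's per-datum list at EVERY datum; what stays displayed there is (Ls) LIP-ARGMIN∘ (print's Thm 1 analyticity half) and the regime letters.

HONEST: sup-norm kinematics of the tree's block average composed by name; nothing of Bałaban's analysis ((Ls), ISOL∘, TUBE-REG∘, GAP♯∘, EXW∘, S2β, crux 20520)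
is proved; no summit statement is proved by a helper; finite volume, fixed lattice data; rung R3 = SU(2) YM₃ on T³ — NOT d = 4, NOT infinite volume, NOT a mass gap,
NOT Clay; the Yang–Mills mass gap is NOT proved.  Sorry-free, axioms standard.

References: T. Bałaban, CMP **109** (1987) 249–301 [Balaban1987RG1] ((0.4), (0.11) p.253); CMP **98** (1985) 17–51 [Balaban1985Averaging] (Prop. 1 p.26, Prop. 2 (52)–(54) p.26);
CMP **102** (1985) 277–309 [Balaban1985Variational] ((2)–(6) p.278, (141)–(143) p.299).
-/

set_option autoImplicit false

noncomputable section

namespace Summit.QuantumFields.YangMills.Theorems.FluctuationComparisonRegPrIntLS2BetaDescentLipschitz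

open Set Function
open scoped BigOperators Matrix.Norms.L2Operator
open Literature.MathematicalPhysics.QuantumFieldTheory.Balaban1983to89
open Literature.MathematicalPhysics.QuantumFieldTheory.Balaban1983to89.T3ContinuumYM3Torus
open Literature.MathematicalPhysics.QuantumFieldTheory.Balaban1983to89.T3UnitLawDensityEML (ℰp)
open Literature.MathematicalPhysics.QuantumFieldTheory.Balaban1983to89.T3TiltDescent (descendTo)
open Literature.MathematicalPhysics.QuantumFieldTheory.Balaban1983to89.T3PrintedRegularMinimiser (RegPr regFibrePr mem_regFibrePr_iff)
open Literature.MathematicalPhysics.QuantumFieldTheory.Balaban1983to89.T3RegularMinimiser (regThreshold)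
open Literature.MathematicalPhysics.QuantumFieldTheory.Balaban1983to89.ExpMeanLog (expMeanLogSU deltaSU)
open Literature.MathematicalPhysics.QuantumFieldTheory.Balaban1983to89.BlockAveraging (blockAvg)
open Summit.QuantumFields.YangMills.Theorems.BlockAvgCorrector (stokesConst stokesConst_nonneg)
open Summit.QuantumFields.YangMills.Theorems.Prop8Criticality (norm_iter_sub_iter_le_of_close)
open Summit.QuantumFields.YangMills.Theorems.MinimiserPin (plaqSmall_two_iter_blockAvg regThreshold_eq)
open Summit.QuantumFields.YangMills.Theorems.Prop7DescendJunction (descendTo_apply)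
open Summit.QuantumFields.YangMills.Theorems.FluctuationComparisonRegPrIntLS2BetaSignedCombLipschitz (dist1_mul_inv_eq_norm_sub)

variable (F : T3Family) {J K : ℕ} (hJK : J ≤ K)

/-! ## §1 Sup form at a base point with a small history -/

/-- ★ **(Lπ), SUP FORM, AT A SMALL HISTORY.**  If the iterated (0.4) averages `M^i W` (`i < K − J`) of the base point `W` are `t`-small, `‖U ℓ − W ℓ‖ ≤ ρ` on every fine
bond and `stokesConst·(t + 4·(30ℓ)^{K−J}·ρ) ≤ 1∕24` (`ℓ = (d+2)L = 5L`), then `‖D_{J,K} U (b) − D_{J,K} W (b)‖ ≤ (30ℓ)^{K−J}·ρ` on every bond of run `J`'s lattice.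
[cite: Balaban1987RG1, (0.4) and (0.11) p.253; Balaban1985Averaging, Prop. 1 p.26] -/
theorem norm_descendTo_sub_descendTo_le_of_iterSmall {t ρ : ℝ} (ht : 0 ≤ t) (hρ : 0 ≤ ρ)
    (W U : GaugeField (F.P K) 0 (Matrix.specialUnitaryGroup (Fin 2) ℂ))
    (hsmall : ∀ i, i < K - J → PlaqSmall t (Averaging.iter (fun i => blockAvg (P := F.P K) (j := i) (expMeanLogSU (n := Fin 2))) i W))
    (hclose : ∀ ℓ : PBond (F.P K) 0, ‖((U ℓ : Matrix.specialUnitaryGroup (Fin 2) ℂ) : Matrix (Fin 2) (Fin 2) ℂ) - (W ℓ : Matrix (Fin 2) (Fin 2) ℂ)‖ ≤ ρ)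
    (h24 : stokesConst (F.P K) * (t + 4 * ((30 * (((3 + 2) * F.L : ℕ) : ℝ)) ^ (K - J) * ρ)) ≤ 1 / 24) :
    ∀ b : PBond (F.P J) 0,
      ‖((descendTo F ℰp J K hJK U b : Matrix.specialUnitaryGroup (Fin 2) ℂ) : Matrix (Fin 2) (Fin 2) ℂ) -
          ((descendTo F ℰp J K hJK W b : Matrix.specialUnitaryGroup (Fin 2) ℂ) : Matrix (Fin 2) (Fin 2) ℂ)‖ ≤
        (30 * (((3 + 2) * F.L : ℕ) : ℝ)) ^ (K - J) * ρ := by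
  intro b
  rw [descendTo_apply, descendTo_apply]
  exact norm_iter_sub_iter_le_of_close ht hρ W U hclose (K - J) hsmall h24 _

/-! ## §2 Sup form at a plaquette-regular base point -/

/-- Every iterated average `M^i W`, `i ≤ K − J`, of a `PlaqSmall (regThreshold F J K e)` field is `2e`-small, for `e` admissible as in (53)
([Balaban1985Averaging] Prop. 2, ✓`MinimiserPin.plaqSmall_two_iter_blockAvg` at `α₀ := e`, `k := K − J`). [cite: Balaban1985Averaging, (52)-(54) p.26] -/
theorem plaqSmall_two_iter_of_plaqSmall_regThreshold {e : ℝ} (he : 0 < e)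
    (he3 : (143 * ((((3 + 4 : ℕ) : ℝ)) ^ 2 / 4) ^ 2) * e ≤ 1 / 3)
    (he2 : 2 * e ≤ 2 * deltaSU (Fin 2) / (((3 + 4) * F.L : ℕ) : ℝ) ^ 2)
    {W : GaugeField (F.P K) 0 (Matrix.specialUnitaryGroup (Fin 2) ℂ)} (hW : PlaqSmall (regThreshold F J K e) W)
    {i : ℕ} (hi : i ≤ K - J) :
    PlaqSmall (2 * e) (Averaging.iter (fun i => blockAvg (P := F.P K) (j := i) (expMeanLogSU (n := Fin 2))) i W) := by
  have h52 : PlaqSmall (e * ((((F.P K).L : ℝ) ^ (K - J))⁻¹) ^ 2) W := by rw [← regThreshold_eq]; exact hW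
  exact plaqSmall_two_iter_blockAvg (N := 2) (P := F.P K) (K - J) he he3 he2 h52 hi

/-- ★★ **(Lπ), SUP FORM, AT A PLAQUETTE-REGULAR BASE POINT.**  `PlaqSmall (regThreshold F J K e) W`, `e` admissible as in (53), `‖U ℓ − W ℓ‖ ≤ ρ` on every fine bond,
`stokesConst·(2e + 4·(30ℓ)^{K−J}·ρ) ≤ 1∕24` ⟹ `‖D U (b) − D W (b)‖ ≤ (30ℓ)^{K−J}·ρ` on every bond of run `J`'s lattice — NO gauge fixing of `W`.
[cite: Balaban1987RG1, (0.4) and (0.11) p.253; Balaban1985Averaging, Prop. 2 (52)-(54) p.26] -/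
theorem norm_descendTo_sub_descendTo_le_of_plaqSmall {e ρ : ℝ} (he : 0 < e) (hρ : 0 ≤ ρ)
    (he3 : (143 * ((((3 + 4 : ℕ) : ℝ)) ^ 2 / 4) ^ 2) * e ≤ 1 / 3)
    (he2 : 2 * e ≤ 2 * deltaSU (Fin 2) / (((3 + 4) * F.L : ℕ) : ℝ) ^ 2)
    (W U : GaugeField (F.P K) 0 (Matrix.specialUnitaryGroup (Fin 2) ℂ)) (hW : PlaqSmall (regThreshold F J K e) W)
    (hclose : ∀ ℓ : PBond (F.P K) 0, ‖((U ℓ : Matrix.specialUnitaryGroup (Fin 2) ℂ) : Matrix (Fin 2) (Fin 2) ℂ) - (W ℓ : Matrix (Fin 2) (Fin 2) ℂ)‖ ≤ ρ)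
    (h24 : stokesConst (F.P K) * (2 * e + 4 * ((30 * (((3 + 2) * F.L : ℕ) : ℝ)) ^ (K - J) * ρ)) ≤ 1 / 24) :
    ∀ b : PBond (F.P J) 0,
      ‖((descendTo F ℰp J K hJK U b : Matrix.specialUnitaryGroup (Fin 2) ℂ) : Matrix (Fin 2) (Fin 2) ℂ) -
          ((descendTo F ℰp J K hJK W b : Matrix.specialUnitaryGroup (Fin 2) ℂ) : Matrix (Fin 2) (Fin 2) ℂ)‖ ≤
        (30 * (((3 + 2) * F.L : ℕ) : ℝ)) ^ (K - J) * ρ :=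
  norm_descendTo_sub_descendTo_le_of_iterSmall F hJK (by positivity) hρ W U
    (fun _ hi => plaqSmall_two_iter_of_plaqSmall_regThreshold F he he3 he2 hW hi.le) hclose h24

/-- The base point of the (T)-chain: `W ∈ regFibrePr F J K hJK e V` is plaquette-regular at threshold `regThreshold F J K e`. [cite: Balaban1985Variational, (2) and (6) p.278] -/
theorem plaqSmall_of_mem_regFibrePr {e : ℝ} {V : GaugeField (F.P J) 0 (Matrix.specialUnitaryGroup (Fin 2) ℂ)}
    {W : GaugeField (F.P K) 0 (Matrix.specialUnitaryGroup (Fin 2) ℂ)} (hW : W ∈ regFibrePr F J K hJK e V) :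
    PlaqSmall (regThreshold F J K e) W :=
  (((mem_regFibrePr_iff F).1 hW).2).plaqSmall

/-- … and so is every gauge copy `u • W` (`dist1` is a class function). [cite: Balaban1985Variational, p.278 (sentence after (3))] -/
theorem plaqSmall_gaugeAct_of_mem_regFibrePr {e : ℝ} {V : GaugeField (F.P J) 0 (Matrix.specialUnitaryGroup (Fin 2) ℂ)}
    {W : GaugeField (F.P K) 0 (Matrix.specialUnitaryGroup (Fin 2) ℂ)} (hW : W ∈ regFibrePr F J K hJK e V)
    (u : Site (F.P K) 0 → Matrix.specialUnitaryGroup (Fin 2) ℂ) :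
    PlaqSmall (regThreshold F J K e) (GaugeField.gaugeAct u W) :=
  (T3PrintedRegularOrbits.plaqSmall_gaugeAct_iff' _ u W).2 (plaqSmall_of_mem_regFibrePr F hJK hW)

/-! ## §3 The (T)-chain's currency: `Σ dist1²` on both sides -/

/-- One term of a sum of squares is at most the sum: `Σ_ℓ dist1 (U ℓ·(W ℓ)⁻¹)² ≤ ρ²`, `0 ≤ ρ` ⟹ `‖U ℓ − W ℓ‖ ≤ ρ` on every bond. [cite: Balaban1985Averaging, (19) p.21] -/
theorem norm_sub_le_of_sum_dist1_sq_le {ρ : ℝ} (hρ : 0 ≤ ρ) (W U : GaugeField (F.P K) 0 (Matrix.specialUnitaryGroup (Fin 2) ℂ))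
    (h : ∑ ℓ : PBond (F.P K) 0, dist1 (U ℓ * (W ℓ)⁻¹) ^ 2 ≤ ρ ^ 2) (ℓ : PBond (F.P K) 0) :
    ‖((U ℓ : Matrix.specialUnitaryGroup (Fin 2) ℂ) : Matrix (Fin 2) (Fin 2) ℂ) - (W ℓ : Matrix (Fin 2) (Fin 2) ℂ)‖ ≤ ρ := by
  rw [← dist1_mul_inv_eq_norm_sub]
  have h1 : dist1 (U ℓ * (W ℓ)⁻¹) ^ 2 ≤ ∑ ℓ' : PBond (F.P K) 0, dist1 (U ℓ' * (W ℓ')⁻¹) ^ 2 :=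
    Finset.single_le_sum (f := fun ℓ' => dist1 (U ℓ' * (W ℓ')⁻¹) ^ 2) (fun ℓ' _ => sq_nonneg _) (Finset.mem_univ ℓ)
  exact (pow_le_pow_iff_left₀ (GaugeGroup.dist1_nonneg _) hρ two_ne_zero).1 (h1.trans h)

/-- ★★★ **(Lπ) IN THE (T)-CHAIN'S CURRENCY, AT A PLAQUETTE-REGULAR BASE POINT.**  `PlaqSmall (regThreshold F J K e) W`, `e` admissible as in (53); on the ball
`Σ_ℓ dist1 (U ℓ·(W ℓ)⁻¹)² ≤ ρ²` with `stokesConst·(2e + 4·(30ℓ)^{K−J}·ρ) ≤ 1∕24`: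
`Σ_b dist1 (D U b·(D W b)⁻¹)² ≤ #PBond_J · ((30ℓ)^{K−J})² · Σ_ℓ dist1 (U ℓ·(W ℓ)⁻¹)²` (`ℓ = 5L`; constants depend on `L`, `K − J`, `#PBond_J` only).
[cite: Balaban1987RG1, (0.4) and (0.11) p.253; Balaban1985Averaging, Prop. 2 (52)-(54) p.26; Balaban1985Variational, (141)-(143) p.299] -/
theorem sum_dist1_descendTo_sq_le_of_plaqSmall {e ρ : ℝ} (he : 0 < e) (hρ : 0 ≤ ρ)
    (he3 : (143 * ((((3 + 4 : ℕ) : ℝ)) ^ 2 / 4) ^ 2) * e ≤ 1 / 3)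
    (he2 : 2 * e ≤ 2 * deltaSU (Fin 2) / (((3 + 4) * F.L : ℕ) : ℝ) ^ 2)
    (W U : GaugeField (F.P K) 0 (Matrix.specialUnitaryGroup (Fin 2) ℂ)) (hW : PlaqSmall (regThreshold F J K e) W)
    (hball : ∑ ℓ : PBond (F.P K) 0, dist1 (U ℓ * (W ℓ)⁻¹) ^ 2 ≤ ρ ^ 2)
    (h24 : stokesConst (F.P K) * (2 * e + 4 * ((30 * (((3 + 2) * F.L : ℕ) : ℝ)) ^ (K - J) * ρ)) ≤ 1 / 24) :
    ∑ b : PBond (F.P J) 0, dist1 (descendTo F ℰp J K hJK U b * (descendTo F ℰp J K hJK W b)⁻¹) ^ 2 ≤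
      (Fintype.card (PBond (F.P J) 0) : ℝ) * ((30 * (((3 + 2) * F.L : ℕ) : ℝ)) ^ (K - J)) ^ 2 *
        ∑ ℓ : PBond (F.P K) 0, dist1 (U ℓ * (W ℓ)⁻¹) ^ 2 := by
  set A : ℝ := (30 * (((3 + 2) * F.L : ℕ) : ℝ)) ^ (K - J) with hA
  set S : ℝ := ∑ ℓ : PBond (F.P K) 0, dist1 (U ℓ * (W ℓ)⁻¹) ^ 2 with hS
  have hA0 : 0 ≤ A := by positivity
  have hS0 : 0 ≤ S := Finset.sum_nonneg fun ℓ _ => sq_nonneg _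
  -- the sup distance is at most `√S ≤ ρ`
  set σ : ℝ := Real.sqrt S with hσ
  have hσ0 : 0 ≤ σ := Real.sqrt_nonneg _
  have hσS : σ ^ 2 = S := Real.sq_sqrt hS0
  have hσρ : σ ≤ ρ := by
    rw [hσ, ← Real.sqrt_sq hρ]
    exact Real.sqrt_le_sqrt hball
  have hclose : ∀ ℓ : PBond (F.P K) 0,
      ‖((U ℓ : Matrix.specialUnitaryGroup (Fin 2) ℂ) : Matrix (Fin 2) (Fin 2) ℂ) - (W ℓ : Matrix (Fin 2) (Fin 2) ℂ)‖ ≤ σ :=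
    norm_sub_le_of_sum_dist1_sq_le F hσ0 W U (by rw [hσS])
  have hst := stokesConst_nonneg (F.P K)
  have h24σ : stokesConst (F.P K) * (2 * e + 4 * (A * σ)) ≤ 1 / 24 :=
    le_trans (mul_le_mul_of_nonneg_left (by nlinarith [mul_le_mul_of_nonneg_left hσρ hA0]) hst) h24
  have hsup := norm_descendTo_sub_descendTo_le_of_plaqSmall F hJK he hσ0 he3 he2 W U hW hclose h24σ
  -- each coarse term is at most `(A σ)² = A²·S`; there are `#PBond_J` of them
  have hterm : ∀ b : PBond (F.P J) 0,
      dist1 (descendTo F ℰp J K hJK U b * (descendTo F ℰp J K hJK W b)⁻¹) ^ 2 ≤ A ^ 2 * S := by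
    intro b
    rw [dist1_mul_inv_eq_norm_sub, ← hσS, ← mul_pow]
    exact pow_le_pow_left₀ (norm_nonneg _) (hsup b) 2
  calc ∑ b : PBond (F.P J) 0, dist1 (descendTo F ℰp J K hJK U b * (descendTo F ℰp J K hJK W b)⁻¹) ^ 2
      ≤ ∑ _b : PBond (F.P J) 0, A ^ 2 * S := Finset.sum_le_sum fun b _ => hterm b
    _ = (Fintype.card (PBond (F.P J) 0) : ℝ) * A ^ 2 * S := by
        rw [Finset.sum_const, Finset.card_univ, nsmul_eq_mul, mul_assoc]

/-- The same in the flipped orientation `dist1 (D W b·(D U b)⁻¹)` ∕ `dist1 (W ℓ·(U ℓ)⁻¹)` (`dist1 g⁻¹ = dist1 g`). [cite: Balaban1985Averaging, (19) p.21] -/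
theorem dist1_mul_inv_comm (A B : Matrix.specialUnitaryGroup (Fin 2) ℂ) : dist1 (A * B⁻¹) = dist1 (B * A⁻¹) := by
  rw [← GaugeGroup.dist1_inv, mul_inv_rev, inv_inv]

/-! ## §4 Packaged `(Lπ)_loc`: one pair of datum-free constants -/

/-- ★★★ **`(Lπ)_loc` PACKAGED.**  For `e` admissible as in (53) with room `stokesConst·(2e) < 1∕24`, there are `Kπ, ρ₀ > 0` depending on `L`, `K − J`, `#PBond_J`, `e` ONLY
(`Kπ² = (#PBond_J + 1)·(30ℓ)^{2(K−J)}`, `ρ₀ = (1∕24 − stokesConst·2e)∕(4·stokesConst·(30ℓ)^{K−J})`) such that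
at EVERY plaquette-regular base point `W` (`PlaqSmall (regThreshold F J K e) W`) and every `U` in the ball `Σ_ℓ dist1 (U ℓ·(W ℓ)⁻¹)² ≤ ρ₀²`:
`Σ_b dist1 (D U b·(D W b)⁻¹)² ≤ Kπ² · Σ_ℓ dist1 (U ℓ·(W ℓ)⁻¹)²`. [cite: Balaban1987RG1, (0.4) and (0.11) p.253; Balaban1985Averaging, Prop. 2 (52)-(54) p.26; Balaban1985Variational, (141)-(143) p.299] -/
theorem exists_descentLipschitz_of_plaqSmall {e : ℝ} (he : 0 < e)
    (he3 : (143 * ((((3 + 4 : ℕ) : ℝ)) ^ 2 / 4) ^ 2) * e ≤ 1 / 3)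
    (he2 : 2 * e ≤ 2 * deltaSU (Fin 2) / (((3 + 4) * F.L : ℕ) : ℝ) ^ 2)
    (he24 : stokesConst (F.P K) * (2 * e) < 1 / 24) :
    ∃ Kπ ρ₀ : ℝ, 0 < Kπ ∧ 0 < ρ₀ ∧
      ∀ W U : GaugeField (F.P K) 0 (Matrix.specialUnitaryGroup (Fin 2) ℂ), PlaqSmall (regThreshold F J K e) W →
        ∑ ℓ : PBond (F.P K) 0, dist1 (U ℓ * (W ℓ)⁻¹) ^ 2 ≤ ρ₀ ^ 2 →
        ∑ b : PBond (F.P J) 0, dist1 (descendTo F ℰp J K hJK U b * (descendTo F ℰp J K hJK W b)⁻¹) ^ 2 ≤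
          Kπ ^ 2 * ∑ ℓ : PBond (F.P K) 0, dist1 (U ℓ * (W ℓ)⁻¹) ^ 2 := by
  set A : ℝ := (30 * (((3 + 2) * F.L : ℕ) : ℝ)) ^ (K - J) with hA
  have hst := stokesConst_nonneg (F.P K)
  have hst0 : 0 < stokesConst (F.P K) := by
    show 0 < ((((F.P K).d + 2) * (F.P K).L : ℕ) : ℝ) ^ 2 / 4
    have : (0 : ℝ) < ((((F.P K).d + 2) * (F.P K).L : ℕ) : ℝ) := by
      have := (F.P K).L_pos
      exact_mod_cast Nat.mul_pos (by omega) this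
    positivity
  have hA1 : 1 ≤ A := one_le_pow₀ (by
    have : (1 : ℝ) ≤ (((3 + 2) * F.L : ℕ) : ℝ) := by
      have := F.hL.2
      exact_mod_cast (show 1 ≤ (3 + 2) * F.L by omega)
    linarith)
  have hA0 : 0 < A := lt_of_lt_of_le one_pos hA1
  -- the room left by `2e` is spent on `4·A·ρ₀`
  set ρ₀ : ℝ := (1 / 24 - stokesConst (F.P K) * (2 * e)) / (4 * stokesConst (F.P K) * A) with hρ₀
  have hρ₀0 : 0 < ρ₀ := div_pos (by linarith) (by positivity)
  refine ⟨Real.sqrt ((Fintype.card (PBond (F.P J) 0) : ℝ) + 1) * A, ρ₀, ?_, hρ₀0, fun W U hW hball => ?_⟩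
  · have : (0 : ℝ) < Real.sqrt ((Fintype.card (PBond (F.P J) 0) : ℝ) + 1) := Real.sqrt_pos.2 (by positivity)
    positivity
  have h24 : stokesConst (F.P K) * (2 * e + 4 * (A * ρ₀)) ≤ 1 / 24 := by
    have hden : 0 < 4 * stokesConst (F.P K) * A := by positivity
    have : 4 * stokesConst (F.P K) * A * ρ₀ = 1 / 24 - stokesConst (F.P K) * (2 * e) := by
      rw [hρ₀, mul_div_cancel₀ _ hden.ne']
    nlinarith
  have hmain := sum_dist1_descendTo_sq_le_of_plaqSmall F hJK he hρ₀0.le he3 he2 W U hW hball h24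
  have hsq : (Real.sqrt ((Fintype.card (PBond (F.P J) 0) : ℝ) + 1) * A) ^ 2 = ((Fintype.card (PBond (F.P J) 0) : ℝ) + 1) * A ^ 2 := by
    rw [mul_pow, Real.sq_sqrt (by positivity)]
  rw [hsq]
  have hS0 : 0 ≤ ∑ ℓ : PBond (F.P K) 0, dist1 (U ℓ * (W ℓ)⁻¹) ^ 2 := Finset.sum_nonneg fun ℓ _ => sq_nonneg _
  refine hmain.trans ?_
  have : 0 ≤ A ^ 2 * ∑ ℓ : PBond (F.P K) 0, dist1 (U ℓ * (W ℓ)⁻¹) ^ 2 := by positivity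
  nlinarith

/-- ★★★ **`(Lπ)_loc` AT THE (T)-CHAIN'S BASE POINT AND ITS GAUGE COPIES**: for `W ∈ regFibrePr F J K hJK e V` and any fine gauge transformation `u`, the packaged Lipschitz bound
of `exists_descentLipschitz_of_plaqSmall` holds at the base point `u • W` (take `u = 1` for `W` itself: `GaugeField.gaugeAct 1 W = W` pointwise) — with the SAME datum-free
`Kπ, ρ₀`.  This is the `(Lπ)_loc` letter of (T7) ∕ the (Lπ) letter of px8's seam, discharged. [cite: Balaban1985Variational, (2)-(6) p.278 and (141)-(143) p.299; Balaban1987RG1, (0.11) p.253] -/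
theorem exists_descentLipschitz_gaugeAct_of_mem_regFibrePr {e : ℝ} (he : 0 < e)
    (he3 : (143 * ((((3 + 4 : ℕ) : ℝ)) ^ 2 / 4) ^ 2) * e ≤ 1 / 3)
    (he2 : 2 * e ≤ 2 * deltaSU (Fin 2) / (((3 + 4) * F.L : ℕ) : ℝ) ^ 2)
    (he24 : stokesConst (F.P K) * (2 * e) < 1 / 24) :
    ∃ Kπ ρ₀ : ℝ, 0 < Kπ ∧ 0 < ρ₀ ∧
      ∀ (V : GaugeField (F.P J) 0 (Matrix.specialUnitaryGroup (Fin 2) ℂ)) (W : GaugeField (F.P K) 0 (Matrix.specialUnitaryGroup (Fin 2) ℂ)),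
        W ∈ regFibrePr F J K hJK e V → ∀ (u : Site (F.P K) 0 → Matrix.specialUnitaryGroup (Fin 2) ℂ)
          (U : GaugeField (F.P K) 0 (Matrix.specialUnitaryGroup (Fin 2) ℂ)),
        ∑ ℓ : PBond (F.P K) 0, dist1 (U ℓ * ((GaugeField.gaugeAct u W) ℓ)⁻¹) ^ 2 ≤ ρ₀ ^ 2 →
        ∑ b : PBond (F.P J) 0, dist1 (descendTo F ℰp J K hJK U b * (descendTo F ℰp J K hJK (GaugeField.gaugeAct u W) b)⁻¹) ^ 2 ≤
          Kπ ^ 2 * ∑ ℓ : PBond (F.P K) 0, dist1 (U ℓ * ((GaugeField.gaugeAct u W) ℓ)⁻¹) ^ 2 := by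
  obtain ⟨Kπ, ρ₀, hK, hρ, h⟩ := exists_descentLipschitz_of_plaqSmall F hJK he he3 he2 he24
  exact ⟨Kπ, ρ₀, hK, hρ, fun V W hW u U hball => h _ U (plaqSmall_gaugeAct_of_mem_regFibrePr F hJK hW u) hball⟩

/-- The same with BOTH sums in the flipped orientation (`dist1 (W′ ·(U ·)⁻¹)`), for consumers who measure from the base point. [cite: Balaban1985Variational, (141)-(143) p.299] -/
theorem exists_descentLipschitz_gaugeAct_of_mem_regFibrePr' {e : ℝ} (he : 0 < e)
    (he3 : (143 * ((((3 + 4 : ℕ) : ℝ)) ^ 2 / 4) ^ 2) * e ≤ 1 / 3)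
    (he2 : 2 * e ≤ 2 * deltaSU (Fin 2) / (((3 + 4) * F.L : ℕ) : ℝ) ^ 2)
    (he24 : stokesConst (F.P K) * (2 * e) < 1 / 24) :
    ∃ Kπ ρ₀ : ℝ, 0 < Kπ ∧ 0 < ρ₀ ∧
      ∀ (V : GaugeField (F.P J) 0 (Matrix.specialUnitaryGroup (Fin 2) ℂ)) (W : GaugeField (F.P K) 0 (Matrix.specialUnitaryGroup (Fin 2) ℂ)),
        W ∈ regFibrePr F J K hJK e V → ∀ (u : Site (F.P K) 0 → Matrix.specialUnitaryGroup (Fin 2) ℂ)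
          (U : GaugeField (F.P K) 0 (Matrix.specialUnitaryGroup (Fin 2) ℂ)),
        ∑ ℓ : PBond (F.P K) 0, dist1 ((GaugeField.gaugeAct u W) ℓ * (U ℓ)⁻¹) ^ 2 ≤ ρ₀ ^ 2 →
        ∑ b : PBond (F.P J) 0, dist1 (descendTo F ℰp J K hJK (GaugeField.gaugeAct u W) b * (descendTo F ℰp J K hJK U b)⁻¹) ^ 2 ≤
          Kπ ^ 2 * ∑ ℓ : PBond (F.P K) 0, dist1 ((GaugeField.gaugeAct u W) ℓ * (U ℓ)⁻¹) ^ 2 := by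
  obtain ⟨Kπ, ρ₀, hK, hρ, h⟩ := exists_descentLipschitz_gaugeAct_of_mem_regFibrePr F hJK he he3 he2 he24
  refine ⟨Kπ, ρ₀, hK, hρ, fun V W hW u U hball => ?_⟩
  simp only [dist1_mul_inv_comm _ (U _), dist1_mul_inv_comm _ (descendTo F ℰp J K hJK U _)] at hball ⊢
  exact h V W hW u U hball

/-! ## §5 The (T)-chain's binder shapes: `(hε₀, hr3, hr2)` of ✓(T2d) `eventually_continuousAt_descendTo_of_mem_regFibrePr` -/

/-- ★★★ **`(Lπ)_loc` WITH THE (T)-CHAIN'S OWN SMALLNESS BINDERS** — the admissibility rows in ✓(T2d)'s spelling (`α₀ := 2ε₀`: `143·(7²∕4)²·(2ε₀) ≤ ⅓`, `2·(2ε₀) ≤ 2δ₂∕(7L)²`) plus the one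
room row `stokesConst·(2ε₀) < 1∕24`; conclusion = `exists_descentLipschitz_gaugeAct_of_mem_regFibrePr` verbatim (so a consumer holding (T2d)'s `hε₀ hr3 hr2` docks by `exact … hε₀ hr3 hr2 h24`).
[cite: Balaban1985Variational, (2)-(6) p.278 and (141)-(143) p.299; Balaban1985Averaging, Prop. 2 (52)-(54) p.26; Balaban1987RG1, (0.11) p.253] -/
theorem exists_descentLipschitz_gaugeAct_of_mem_regFibrePr_T {ε₀ : ℝ} (hε₀ : 0 < ε₀)
    (hr3 : (143 * ((((3 + 4 : ℕ) : ℝ)) ^ 2 / 4) ^ 2) * (2 * ε₀) ≤ 1 / 3)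
    (hr2 : 2 * (2 * ε₀) ≤ 2 * deltaSU (Fin 2) / (((3 + 4) * F.L : ℕ) : ℝ) ^ 2)
    (h24 : stokesConst (F.P K) * (2 * ε₀) < 1 / 24) :
    ∃ Kπ ρ₀ : ℝ, 0 < Kπ ∧ 0 < ρ₀ ∧
      ∀ (V : GaugeField (F.P J) 0 (Matrix.specialUnitaryGroup (Fin 2) ℂ)) (W : GaugeField (F.P K) 0 (Matrix.specialUnitaryGroup (Fin 2) ℂ)),
        W ∈ regFibrePr F J K hJK ε₀ V → ∀ (u : Site (F.P K) 0 → Matrix.specialUnitaryGroup (Fin 2) ℂ)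
          (U : GaugeField (F.P K) 0 (Matrix.specialUnitaryGroup (Fin 2) ℂ)),
        ∑ ℓ : PBond (F.P K) 0, dist1 (U ℓ * ((GaugeField.gaugeAct u W) ℓ)⁻¹) ^ 2 ≤ ρ₀ ^ 2 →
        ∑ b : PBond (F.P J) 0, dist1 (descendTo F ℰp J K hJK U b * (descendTo F ℰp J K hJK (GaugeField.gaugeAct u W) b)⁻¹) ^ 2 ≤
          Kπ ^ 2 * ∑ ℓ : PBond (F.P K) 0, dist1 (U ℓ * ((GaugeField.gaugeAct u W) ℓ)⁻¹) ^ 2 := by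
  have h143 : 0 ≤ (143 * ((((3 + 4 : ℕ) : ℝ)) ^ 2 / 4) ^ 2) := by positivity
  have he3 : (143 * ((((3 + 4 : ℕ) : ℝ)) ^ 2 / 4) ^ 2) * ε₀ ≤ 1 / 3 := by nlinarith
  have he2 : 2 * ε₀ ≤ 2 * deltaSU (Fin 2) / (((3 + 4) * F.L : ℕ) : ℝ) ^ 2 := by linarith
  exact exists_descentLipschitz_gaugeAct_of_mem_regFibrePr F hJK hε₀ he3 he2 h24

/-! ## §6 (T7)'s `(Lπ)_loc` binder, byte-exact supplier shape (px21 g19 00:44:07Z (B)), and an `L`-only threshold edition -/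

/-- ★★★ **THE (T7) SUPPLIER.**  At a plaquette-regular `U₀` (`e` admissible as in (53), room `stokesConst·2e < 1∕24`):
`∃ ρ₀ Kπ, 0 < ρ₀ ∧ 0 ≤ Kπ ∧ ∀ B ρ, 0 ≤ ρ → ρ ≤ ρ₀ → (∀ ℓ, ‖↑(U₀ ℓ) − ↑(B ℓ)‖ ≤ ρ) → ∀ b, ‖↑(D U₀ b) − ↑(D B b)‖ ≤ Kπ·ρ` — the text of (T7b)'s `hLip` binder after its
`∀ ρ₀ Kπ, 0 < ρ₀ → 0 ≤ Kπ →` prefix (`Kπ = (30ℓ)^{K−J}`, `ρ₀ = (1∕24 − stokesConst·2e)∕(4·stokesConst·(30ℓ)^{K−J})`).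
[cite: Balaban1987RG1, (0.4) and (0.11) p.253; Balaban1985Averaging, Prop. 2 (52)-(54) p.26] -/
theorem exists_supLipschitz_of_plaqSmall {e : ℝ} (he : 0 < e)
    (he3 : (143 * ((((3 + 4 : ℕ) : ℝ)) ^ 2 / 4) ^ 2) * e ≤ 1 / 3)
    (he2 : 2 * e ≤ 2 * deltaSU (Fin 2) / (((3 + 4) * F.L : ℕ) : ℝ) ^ 2)
    (he24 : stokesConst (F.P K) * (2 * e) < 1 / 24)
    (U₀ : GaugeField (F.P K) 0 (Matrix.specialUnitaryGroup (Fin 2) ℂ)) (hU₀ : PlaqSmall (regThreshold F J K e) U₀) :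
    ∃ ρ₀ Kπ : ℝ, 0 < ρ₀ ∧ 0 ≤ Kπ ∧
      ∀ (B : GaugeField (F.P K) 0 (Matrix.specialUnitaryGroup (Fin 2) ℂ)) (ρ : ℝ), 0 ≤ ρ → ρ ≤ ρ₀ →
        (∀ ℓ : PBond (F.P K) 0, ‖(U₀ ℓ : Matrix (Fin 2) (Fin 2) ℂ) - (B ℓ : Matrix (Fin 2) (Fin 2) ℂ)‖ ≤ ρ) →
        ∀ b : PBond (F.P J) 0,
          ‖((descendTo F ℰp J K hJK U₀ b : Matrix.specialUnitaryGroup (Fin 2) ℂ) : Matrix (Fin 2) (Fin 2) ℂ) -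
              ((descendTo F ℰp J K hJK B b : Matrix.specialUnitaryGroup (Fin 2) ℂ) : Matrix (Fin 2) (Fin 2) ℂ)‖ ≤ Kπ * ρ := by
  set A : ℝ := (30 * (((3 + 2) * F.L : ℕ) : ℝ)) ^ (K - J) with hA
  have hst := stokesConst_nonneg (F.P K)
  have hst0 : 0 < stokesConst (F.P K) := by
    show 0 < ((((F.P K).d + 2) * (F.P K).L : ℕ) : ℝ) ^ 2 / 4
    have : (0 : ℝ) < ((((F.P K).d + 2) * (F.P K).L : ℕ) : ℝ) := by
      have := (F.P K).L_pos
      exact_mod_cast Nat.mul_pos (by omega) this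
    positivity
  have hA0 : 0 < A := by
    have : (0 : ℝ) < (((3 + 2) * F.L : ℕ) : ℝ) := by
      have := F.hL.2
      exact_mod_cast (show 0 < (3 + 2) * F.L by omega)
    rw [hA]; positivity
  set ρ₀ : ℝ := (1 / 24 - stokesConst (F.P K) * (2 * e)) / (4 * stokesConst (F.P K) * A) with hρ₀
  have hρ₀0 : 0 < ρ₀ := div_pos (by linarith) (by positivity)
  refine ⟨ρ₀, A, hρ₀0, hA0.le, fun B ρ hρ hρρ₀ hclose b => ?_⟩
  have h24 : stokesConst (F.P K) * (2 * e + 4 * (A * ρ)) ≤ 1 / 24 := by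
    have hden : 0 < 4 * stokesConst (F.P K) * A := by positivity
    have : 4 * stokesConst (F.P K) * A * ρ₀ = 1 / 24 - stokesConst (F.P K) * (2 * e) := by
      rw [hρ₀, mul_div_cancel₀ _ hden.ne']
    nlinarith [mul_le_mul_of_nonneg_left hρρ₀ (le_of_lt hden)]
  have h := norm_descendTo_sub_descendTo_le_of_plaqSmall F hJK he hρ he3 he2 U₀ B hU₀ (fun ℓ => by rw [norm_sub_rev]; exact hclose ℓ) h24 b
  rw [norm_sub_rev]
  exact h

/-- ★★★ **THE (T7) SUPPLIER AT `U₀ ∈ regFibrePr F J K hJK e V`** (same constants). [cite: Balaban1985Variational, (2) and (6) p.278; Balaban1987RG1, (0.11) p.253] -/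
theorem exists_supLipschitz_of_mem_regFibrePr {e : ℝ} (he : 0 < e)
    (he3 : (143 * ((((3 + 4 : ℕ) : ℝ)) ^ 2 / 4) ^ 2) * e ≤ 1 / 3)
    (he2 : 2 * e ≤ 2 * deltaSU (Fin 2) / (((3 + 4) * F.L : ℕ) : ℝ) ^ 2)
    (he24 : stokesConst (F.P K) * (2 * e) < 1 / 24)
    {V : GaugeField (F.P J) 0 (Matrix.specialUnitaryGroup (Fin 2) ℂ)} {U₀ : GaugeField (F.P K) 0 (Matrix.specialUnitaryGroup (Fin 2) ℂ)}
    (hU₀ : U₀ ∈ regFibrePr F J K hJK e V) :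
    ∃ ρ₀ Kπ : ℝ, 0 < ρ₀ ∧ 0 ≤ Kπ ∧
      ∀ (B : GaugeField (F.P K) 0 (Matrix.specialUnitaryGroup (Fin 2) ℂ)) (ρ : ℝ), 0 ≤ ρ → ρ ≤ ρ₀ →
        (∀ ℓ : PBond (F.P K) 0, ‖(U₀ ℓ : Matrix (Fin 2) (Fin 2) ℂ) - (B ℓ : Matrix (Fin 2) (Fin 2) ℂ)‖ ≤ ρ) →
        ∀ b : PBond (F.P J) 0,
          ‖((descendTo F ℰp J K hJK U₀ b : Matrix.specialUnitaryGroup (Fin 2) ℂ) : Matrix (Fin 2) (Fin 2) ℂ) -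
              ((descendTo F ℰp J K hJK B b : Matrix.specialUnitaryGroup (Fin 2) ℂ) : Matrix (Fin 2) (Fin 2) ℂ)‖ ≤ Kπ * ρ :=
  exists_supLipschitz_of_plaqSmall F hJK he he3 he2 he24 U₀ (plaqSmall_of_mem_regFibrePr F hJK hU₀)

/-- **AN `L`-ONLY THRESHOLD `e_π(L)`** under which the three smallness rows of this file hold: `143·(7²∕4)²·e ≤ ⅓`, `2e ≤ 2δ₂∕(7L)²`, `((5L)²∕4)·(2e) < 1∕24`
(`stokesConst (F.P K) = ((5L)²∕4)` for every `K`). [cite: Balaban1985Averaging, (53) p.26] -/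
theorem exists_ePi (L : ℕ) (hL : 1 ≤ L) : ∃ eπ : ℝ, 0 < eπ ∧ ∀ e : ℝ, 0 < e → e ≤ eπ →
    (143 * ((((3 + 4 : ℕ) : ℝ)) ^ 2 / 4) ^ 2) * e ≤ 1 / 3 ∧
      2 * e ≤ 2 * deltaSU (Fin 2) / (((3 + 4) * L : ℕ) : ℝ) ^ 2 ∧
      ((((3 + 2) * L : ℕ) : ℝ) ^ 2 / 4) * (2 * e) < 1 / 24 := by
  have hδ := ExpMeanLog.deltaSU_pos (n := Fin 2)
  have h7L : (0 : ℝ) < (((3 + 4) * L : ℕ) : ℝ) := by exact_mod_cast Nat.mul_pos (by omega) (by omega)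
  have h5L : (1 : ℝ) ≤ (((3 + 2) * L : ℕ) : ℝ) := by exact_mod_cast (show 1 ≤ (3 + 2) * L by omega)
  have hc₁0 : (0 : ℝ) < 143 * ((((3 + 4 : ℕ) : ℝ)) ^ 2 / 4) ^ 2 := by positivity
  have hc₂0 : (0 : ℝ) < deltaSU (Fin 2) / (((3 + 4) * L : ℕ) : ℝ) ^ 2 := by positivity
  have hc₃0 : (0 : ℝ) < 1 / (100 * (((3 + 2) * L : ℕ) : ℝ) ^ 2) := by positivity
  refine ⟨min (1 / (3 * (143 * ((((3 + 4 : ℕ) : ℝ)) ^ 2 / 4) ^ 2)))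
      (min (deltaSU (Fin 2) / (((3 + 4) * L : ℕ) : ℝ) ^ 2) (1 / (100 * (((3 + 2) * L : ℕ) : ℝ) ^ 2))),
    lt_min (by positivity) (lt_min hc₂0 hc₃0), fun e he hle => ⟨?_, ?_, ?_⟩⟩
  · have h1 : e ≤ 1 / (3 * (143 * ((((3 + 4 : ℕ) : ℝ)) ^ 2 / 4) ^ 2)) := hle.trans (min_le_left _ _)
    calc (143 * ((((3 + 4 : ℕ) : ℝ)) ^ 2 / 4) ^ 2) * e
        ≤ (143 * ((((3 + 4 : ℕ) : ℝ)) ^ 2 / 4) ^ 2) * (1 / (3 * (143 * ((((3 + 4 : ℕ) : ℝ)) ^ 2 / 4) ^ 2))) :=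
          mul_le_mul_of_nonneg_left h1 hc₁0.le
      _ = 1 / 3 := by field_simp
  · have h2 : e ≤ deltaSU (Fin 2) / (((3 + 4) * L : ℕ) : ℝ) ^ 2 := hle.trans ((min_le_right _ _).trans (min_le_left _ _))
    have : 2 * deltaSU (Fin 2) / (((3 + 4) * L : ℕ) : ℝ) ^ 2 = 2 * (deltaSU (Fin 2) / (((3 + 4) * L : ℕ) : ℝ) ^ 2) := by ring
    rw [this]
    linarith
  · have h3 : e ≤ 1 / (100 * (((3 + 2) * L : ℕ) : ℝ) ^ 2) := hle.trans ((min_le_right _ _).trans (min_le_right _ _))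
    have hsq : (1 : ℝ) ≤ (((3 + 2) * L : ℕ) : ℝ) ^ 2 := one_le_pow₀ h5L
    have hx : 0 < 100 * (((3 + 2) * L : ℕ) : ℝ) ^ 2 := by positivity
    have h3' : (((3 + 2) * L : ℕ) : ℝ) ^ 2 * e ≤ 1 / 100 := by
      calc (((3 + 2) * L : ℕ) : ℝ) ^ 2 * e ≤ (((3 + 2) * L : ℕ) : ℝ) ^ 2 * (1 / (100 * (((3 + 2) * L : ℕ) : ℝ) ^ 2)) :=
            mul_le_mul_of_nonneg_left h3 (by positivity)
        _ = 1 / 100 := by field_simp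
    nlinarith

/-- ★★★ **THE (T7) SUPPLIER, THRESHOLD EDITION**: for every block size `L ≥ 1` there is `e_π(L) > 0` such that at EVERY family with `F.L = L`, every height pair `J ≤ K`, every
`0 < e ≤ e_π(L)`, every datum `V` and every `U₀ ∈ regFibrePr F J K hJK e V`, (T7b)'s `hLip` supplier holds — so a consumer takes `e ≤ min (e₈ L) (e_π L)` and (Lπ)_loc leaves its list.
[cite: Balaban1985Variational, (2)-(6) p.278 and (141)-(143) p.299; Balaban1987RG1, (0.11) p.253; Balaban1985Averaging, Prop. 2 (52)-(54) p.26] -/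
theorem exists_threshold_supLipschitz (L : ℕ) (hL : 1 ≤ L) : ∃ eπ : ℝ, 0 < eπ ∧
    ∀ (F : T3Family), F.L = L → ∀ (J K : ℕ) (hJK : J ≤ K) (e : ℝ), 0 < e → e ≤ eπ →
      ∀ (V : GaugeField (F.P J) 0 (Matrix.specialUnitaryGroup (Fin 2) ℂ)) (U₀ : GaugeField (F.P K) 0 (Matrix.specialUnitaryGroup (Fin 2) ℂ)),
        U₀ ∈ regFibrePr F J K hJK e V →
        ∃ ρ₀ Kπ : ℝ, 0 < ρ₀ ∧ 0 ≤ Kπ ∧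
          ∀ (B : GaugeField (F.P K) 0 (Matrix.specialUnitaryGroup (Fin 2) ℂ)) (ρ : ℝ), 0 ≤ ρ → ρ ≤ ρ₀ →
            (∀ ℓ : PBond (F.P K) 0, ‖(U₀ ℓ : Matrix (Fin 2) (Fin 2) ℂ) - (B ℓ : Matrix (Fin 2) (Fin 2) ℂ)‖ ≤ ρ) →
            ∀ b : PBond (F.P J) 0,
              ‖((descendTo F ℰp J K hJK U₀ b : Matrix.specialUnitaryGroup (Fin 2) ℂ) : Matrix (Fin 2) (Fin 2) ℂ) -
                  ((descendTo F ℰp J K hJK B b : Matrix.specialUnitaryGroup (Fin 2) ℂ) : Matrix (Fin 2) (Fin 2) ℂ)‖ ≤ Kπ * ρ := by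
  obtain ⟨eπ, heπ, h⟩ := exists_ePi L hL
  refine ⟨eπ, heπ, fun F hFL J K hJK e he hle V U₀ hU₀ => ?_⟩
  obtain ⟨he3, he2, he24⟩ := h e he hle
  subst hFL
  exact exists_supLipschitz_of_mem_regFibrePr F hJK he he3 he2 he24 hU₀

end Summit.QuantumFields.YangMills.Theorems.FluctuationComparisonRegPrIntLS2BetaDescentLipschitz

end
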